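import Mathlib.Analysis.Complex.Basic
import Literature.Computability.Complexity.ReductionsProofs
import Literature.NumberTheory.DiophantineGeometry.SymmetricGroupReps
import Literature.NumberTheory.DiophantineGeometry.SchurWeylPlethysm
import HarnessLib
import HarnessLib.Audit

/-!
# Barrier catalogue `ValiantsHypothesis`: deciding positivity of Kronecker and plethysm
coefficients is NP-hard (Ikenmeyer–Mulmuley–Walter 2017; Fischer–Ikenmeyer 2020) — the
polynomial-time positivity hypotheses of GCT's "flip" fail in general unless `P = NP`

D-0021 barrier entry for the summit `ValiantsHypothesis` (`VP_ℂ ≠ VNP_ℂ`), sub-approach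
"geometric complexity theory", meta-strategy "the flip via saturated and positive integer
programming" (Mulmuley, GCT6): find representation-theoretic obstructions EXPLICITLY and
efficiently, which presupposes that positivity of the multiplicities involved — Kronecker
coefficients (coordinate ring of the orbit of `det_n`) and plethysm coefficients (coordinate
rings of spaces of forms) — can be decided in polynomial time, as it can for
Littlewood–Richardson coefficients. Technique class: that positivity hypothesis
(`KroneckerPositivityInP`, `PlethysmPositivityInP` — registered OPEN statements, `[status: open]`,
CONVENTIONS §4: hypotheses taken as `(hP : …)`, not named facts, never to be discharged). The
barrier: both decision problems are NP-hard, so the hypotheses imply `NP ⊆ P`.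

**The printed results** (checked with `lit read`).

* Ikenmeyer–Mulmuley–Walter, Comput. Complexity 26 (2017) 949–992 (arXiv:1507.02955, held),
  §1.1: `k^λ_{μ,π}` = multiplicity of `V_μ(GL_r) ⊗ V_π(GL_r)` in `V_λ(GL_{r²})` restricted to
  `GL_r × GL_r` (`|λ| = |μ| = |π|`; by Schur–Weyl, proof of Lemma 2.1, the multiplicity of the
  Specht module `[λ]` in `[μ] ⊗ [π]`, `= dim([λ] ⊗ [μ] ⊗ [π])^{S_n}`); "Let KRONECKER be the
  problem of deciding positivity of `k^λ_{μ,π}`, given `λ`, `μ`, and `π` in unary." Thm. 1.1: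
  "KRONECKER is NP-hard." "It was conjectured in [GCT6] that the problem of deciding positivity
  of Kronecker coefficients is in `P`. This result shows that this is not so, in general,
  assuming that `P ≠ NP`. However, only the weaker version of this conjecture for rectangular
  Kronecker coefficients [GCT2, burgnonvanish] is needed in GCT, since only such coefficients
  arise in the study of the orbit closure of the determinant." §1.5: "NP-hard under
  polynomial-time Karp reductions" (refined Thm.), reduction from 3-DIMENSIONAL MATCHING; "the
  membership problem for the Kronecker cone is in NP ∩ coNP" (citing [BCMW]). §1.3: rectangular
  `k^λ_{δ(λ),δ(λ)}`, `δ(λ) = (d,…,d)` (`r` times), `d = |λ|/r`. §1.7: "the problem of deciding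
  positivity of rectangular Kronecker coefficients is not expected to be NP-hard. Rather it is
  conjectured [GCT6] to be in `P`, and this is supported by the result (Theorem 6.9) here."
  §6.5: "It is conjectured in [GCT6] that the problem deciding positivity of the rectangular
  Kronecker coefficient `k^λ_{δ(λ),δ(λ)}` is in `P`." Thm. 6.9: `t^λ_{δ,δ} > 0` for `λ ⊢ dr`
  with at most `min(d², r²)` rows. Thm. 1.2: a `#P`-formula for a subclass of type NP.
* Fischer–Ikenmeyer, Comput. Complexity 29 (2020) 8 (arXiv:2002.00788, held), §2:
  `Sym^n Sym^m V = ⊕_λ (S^λ V)^{⊕ a_λ(n,m)}`, "often called the plethysm coefficient"; §3: "In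
  all problems the inputs can be encoded in binary or in unary, as it makes no difference for our
  results below. The hardness results still hold for the unary encoding"; Problem 2
  (PLETHYSMPOSITIVITY): "Given a partition `λ` and two integers `n` and `m`, output 'accept' if
  `a_λ(n,m) > 0`"; Thm. 1: "PLETHYSMPOSITIVITY(`m`) and DUALPLETHYSMPOSITIVITY(`m`) are NP-hard
  for any fixed `m ≥ 3`. In particular, PLETHYSMPOSITIVITY and DUALPLETHYSMPOSITIVITY are
  NP-hard." Thm. 2 (`#P`-hard), Thm. 3 (PLETHYSM is `GapP`-complete), Prop. 1 (fixed OUTER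
  parameter `n`: polynomial time). §1: "the recent paper [IkenmeyerMW2017] proves the
  NP-hardness of deciding the positivity of the Kronecker coefficient. This was a setback for the
  GCT program, as it was originally conjectured that Kronecker positivity would be decidable in
  polynomial time, much in the same way as the well-known Littlewood-Richardson coefficients ...
  Such a result would have made the search for obstructions (i.e., inequalities between
  coefficients) much easier."
* Bürgisser, arXiv:2406.06217, §7: "positivity of Littlewood-Richardson coefficients can be
  tested in polynomial time ..., which led to the early GCT conjecture [gct6] that this should
  also be possible for plethysm coefficients and Kronecker coefficients ... For the latter this
  was refuted in [ik-m-w:15]"; "[Fischer–Ikenmeyer] ... deciding positivity of plethysm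
  coefficients is NP-hard."
* Mulmuley, GCT6, arXiv:0704.0229 — WHERE THE HYPOTHESES ARE POSED (held as the TeX text of the
  2009 revision; theorem-like environments are numbered `<section>.<n>` within each chapter).
  Ch. 1 §1 "The decision problems": Problem 1.1 "(Decision version of the Kronecker problem)
  Given partitions `λ, μ, π`, decide nonvanishing of the Kronecker coefficient `k^π_{λ,μ}`";
  Problem 1.2 "(Decision version of the plethysm problem)": nonvanishing of the plethysm
  constant `a^π_{λ,μ}`, the multiplicity of `V_π(GL_n)` in `V_λ(GL(V_μ))` (Fischer–Ikenmeyer's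
  `a_λ(n,m)` is `a^λ_{(n),(m)}`); Question 1.5: "Do the decision problems above … belong to
  `P`?"; then: "Question 1.5 may not have an affirmative answer in general; i.e., these problems
  may not be in `P` in their strict form stated above. The following main conjectural
  complexity-theoretic positivity hypothesis governing the flip says that the relaxed forms of
  these decision problems … belong to `P`" — Hypothesis 1.6 (PHflip), the relaxation for the
  plethysm constant being (a) stretched constants `a^{bπ}_{bλ,bμ}`, `b > c·h^{c'}`, and (b) an
  algorithm "which works correctly on almost all `λ, μ` and `π`". Ch. 1 §6 "The plethysm
  problem": Thm. 6.3 (PSPACE: `a^π_{λ,μ}` "can be computed in `poly(⟨λ⟩,⟨μ⟩,⟨π⟩)` space");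
  Hypothesis 6.4 (PH1: a polytope `P^π_{λ,μ}` whose Ehrhart quasi-polynomial is the stretching
  quasi-polynomial, `a^π_{λ,μ}` = its number of integer points, membership decidable in
  polynomial time); before Hypothesis 6.5 (SH): "The recent article [rosas] shows that strict
  saturation need not hold for the Kronecker coefficients, as was conjectured in the earlier
  version of this paper"; Thm. 6.8: PHflip for the plethysm constant "is implied by the
  mathematical positivity hypotheses PH1 and SH". Ch. 5 §1, Prop. 1.2: "This implies that the
  Kronecker coefficient (Problem 1.1) can be computed in PSPACE." Ch. 7 §6.3 (det vs. perm): for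
  `g = det_m`, "the subgroup restriction problem for the embedding `ρ : G_g ↪ G` is essentially
  the Kronecker problem", and Hypothesis 6.1 (PH1) posits a polytope `Q^d_λ` whose number of
  integer points is `m^d_λ`, the multiplicity of `(ℂg)^d` in `V_λ(G)` — the `d`-th power of the
  determinant representation of `GL_m`, whose partition "is a rectangle of height `m` and width
  `d`" — i.e. the rectangular Kronecker coefficient of IMW §1.3.

**Rendering.** Languages over `{0,1}` with a fixed UNARY encoding (`unaryNat a = 1^a 0`, a
partition as the unary blocks of its parts in weakly decreasing order followed by an empty
block, tuples by concatenation — uniquely decodable since parts are positive; any two such unary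
encodings are linear-time inter-translatable, so NP-hardness does not depend on the choice).
`KroneckerPositivity` = encodings of triples `(λ, μ, π)` of partitions of a common `D` with
`g(λ, μ, π) > 0`, where `k^λ_{μ,π}` is the tree's
`Literature.NumberTheory.DiophantineGeometry.kroneckerCoeff ℂ μ π λ`
(`dim Hom_{S_D}(S^μ ⊗ S^π, S^λ)`, the multiplicity of `[λ]` in `[μ] ⊗ [π]`);
`PlethysmPositivity` = encodings of `(λ, n, m)` with `λ ⊢ n·m` and `a_λ(n,m) > 0`, where
`a_λ(n,m)` is the tree's
`Literature.NumberTheory.DiophantineGeometry.plethysmCoeffOfPartition ℂ (n*m) m λ` (multiplicity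
of `V(λ)` in `Sym^n Sym^m ℂ^N` for `N = n·m ≥ ℓ(λ)`; the classical coefficient does not depend on
`N ≥ ℓ(λ)`, and `N = |λ|` is fixed here to avoid that remark); `PlethysmPositivityFixed m` the
slice with `m` fixed. NP-hardness is the tree's Karp notion
`Literature.Computability.Complexity.IsNPHard` (`∀ L' ∈ NP, L' ≤ₚ L`). The hypotheses of GCT6 are
membership in `Literature.Computability.Complexity.Classes.P`; they are registered OPEN
statements (docstrings `OPEN CONJECTURE — … [status: open]`, CONVENTIONS §4), not named facts:
`KroneckerPositivityInP` and `PlethysmPositivityInP` keep their names because the no-go theorems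
take them as hypotheses; the consequence `NP ⊆ P` is PROVED from the facts with the tree's
`NP_subset_P_of_isNPHard_of_mem_P_holds`. The rectangular problem
`RectangularKroneckerPositivity` and its conjectured membership in `P` (the form GCT needs,
`RectangularKroneckerPositivityInPConjecture`, open) are DEFINED for the scope caveat; nothing is
asserted about them.

## References

* [IkenmeyerMulmuleyWalter2017] C. Ikenmeyer, K. D. Mulmuley, M. Walter, *On vanishing of
  Kronecker coefficients*, Comput. Complexity 26 (2017) 949–992 (arXiv:1507.02955), abstract,
  §1.1 (KRONECKER, Thm. 1.1, the GCT6 conjecture), §1.2 (Thm. 1.2), §1.3 (Def. 1.3), §1.4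
  (Thms. 1.4–1.5), §1.5, §1.7, §6 (Thms. 6.3, 6.4, 6.6, 6.9), §6.5.
* [FischerIkenmeyer2020] N. Fischer, C. Ikenmeyer, *The computational complexity of plethysm
  coefficients*, Comput. Complexity 29 (2020) 8 (arXiv:2002.00788), abstract, §1, §2 ((2)),
  §3 (Problems 1–4, Thm. 1, Thm. 2, Thm. 3, Prop. 1, Lemma 1).
* [MulmuleyGCT6] K. D. Mulmuley, *Geometric complexity theory VI: the flip via saturated and
  positive integer programming in representation theory and algebraic geometry*,
  arXiv:0704.0229 (revised version, 2009; held as TeX text), Ch. 1 §1 (Problems 1.1–1.2,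
  Question 1.5, Hypothesis 1.6 PHflip), Ch. 1 §6 (Thm. 6.3, Hypotheses 6.4 PH1 and 6.5 SH,
  Thm. 6.8), Ch. 5 §1 (Prop. 1.2, Thm. 1.3), Ch. 7 §6.3 (Hypothesis 6.1 PH1). IMW cite the 2010
  technical-report version *Geometric complexity theory VI: the flip via positivity*.
* [Burgisser2024Completeness] §7.
-/

noncomputable section

namespace Literature.Barriers.ValiantsHypothesis

open Literature.Computability.Complexity Literature.Computability.Complexity.Classes Literature.Computability.Complexity.Nondeterministic Literature.NumberTheory.DiophantineGeometry

/-! ### Unary encodings -/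

/-- Unary encoding of a natural number: `a ↦ 1^a 0`. [cite: IkenmeyerMulmuleyWalter2017, §1.1 ("given λ, μ, and π in unary")] -/
def unaryNat (a : ℕ) : List Bool :=
  List.replicate a true ++ [false]

/-- Unary encoding of a list of naturals: the blocks `1^{aᵢ} 0` followed by a terminating empty
block `0` (uniquely decodable when all `aᵢ > 0`). [cite: IkenmeyerMulmuleyWalter2017, §1.1] -/
def unaryList (l : List ℕ) : List Bool :=
  (l.map unaryNat).flatten ++ [false]

/-- Unary encoding of a partition: its parts in weakly decreasing order, as a `unaryList`.
[cite: IkenmeyerMulmuleyWalter2017, §1.1] -/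
def encodePartition {d : ℕ} (lam : Nat.Partition d) : List Bool :=
  unaryList lam.sortedParts

/-- The length of the unary code of `a` is `a + 1`. [folklore] -/
@[simp] theorem length_unaryNat (a : ℕ) : (unaryNat a).length = a + 1 := by
  simp [unaryNat]

/-- `unaryNat` is injective. [folklore] -/
theorem unaryNat_injective : Function.Injective unaryNat := by
  intro a b h
  have := congrArg List.length h
  simpa using this

/-! ### The decision problems -/

/-- **KRONECKER** (IMW §1.1): unary encodings `⟨λ, μ, π⟩` of partition triples of a common size
with positive Kronecker coefficient `k^λ_{μ,π} = g(λ, μ, π)` = multiplicity of `[λ]` in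
`[μ] ⊗ [π]` (tree: `kroneckerCoeff ℂ μ π λ`). [cite: IkenmeyerMulmuleyWalter2017, §1.1 (KRONECKER)] -/
def KroneckerPositivity : Language Bool :=
  {w : List Bool | ∃ (D : ℕ) (lam μ π : Nat.Partition D),
    w = encodePartition lam ++ encodePartition μ ++ encodePartition π ∧
      0 < kroneckerCoeff ℂ μ π lam}

/-- **Rectangular KRONECKER** (the case GCT needs, IMW §1.1, §1.3): unary encodings `⟨λ, r⟩`
with `r ∣ |λ|`, `|λ| = r·d`, and `k^λ_{δ(λ),δ(λ)} > 0` for the rectangle `δ(λ) = (d,…,d)`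
(`r` parts; tree `Nat.Partition.rectangle r d`). Defined for the scope caveat only.
[cite: IkenmeyerMulmuleyWalter2017, §1.3 (rectangular Kronecker coefficients)] -/
def RectangularKroneckerPositivity : Language Bool :=
  {w : List Bool | ∃ (r d : ℕ) (lam : Nat.Partition (r * d)),
    w = encodePartition lam ++ unaryNat r ∧
      0 < kroneckerCoeff ℂ (Nat.Partition.rectangle r d) (Nat.Partition.rectangle r d) lam}

/-- **PLETHYSMPOSITIVITY** (FI Problem 2): unary encodings `⟨λ, n, m⟩` with `λ ⊢ n·m` and
`a_λ(n,m) > 0`, `a_λ(n,m)` the multiplicity of `V(λ)` in `Sym^n Sym^m V` (tree: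
`plethysmCoeffOfPartition ℂ (n*m) m λ`, `dim V = n·m ≥ ℓ(λ)`). Instances with `|λ| ≠ n·m`
(where `a_λ(n,m) = 0`) are non-members. [cite: FischerIkenmeyer2020, §3 (Problem 2)] -/
def PlethysmPositivity : Language Bool :=
  {w : List Bool | ∃ (n m : ℕ) (lam : Nat.Partition (n * m)),
    w = encodePartition lam ++ unaryNat n ++ unaryNat m ∧
      0 < plethysmCoeffOfPartition ℂ (n * m) m lam}

/-- **PLETHYSMPOSITIVITY(`m`)** (FI §3: "versions where `m` ... is fixed"): the inner
parameter `m` fixed, inputs `⟨λ, n⟩`. [cite: FischerIkenmeyer2020, §3 (fixed-parameter versions)] -/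
def PlethysmPositivityFixed (m : ℕ) : Language Bool :=
  {w : List Bool | ∃ (n : ℕ) (lam : Nat.Partition (n * m)),
    w = encodePartition lam ++ unaryNat n ∧ 0 < plethysmCoeffOfPartition ℂ (n * m) m lam}

/-! ### The printed results as named facts (D-0014) -/

/-- **Ikenmeyer–Mulmuley–Walter 2017, Thm. 1.1: "KRONECKER is NP-hard"** (deciding
`k^λ_{μ,π} > 0` given `λ, μ, π` in unary; under polynomial-time Karp reductions, §1.5), in
the tree's notion `IsNPHard` (every `NP` language Karp-reduces to it).
[cite: IkenmeyerMulmuleyWalter2017, Thm. 1.1] -/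
def IMW2017_kroneckerNPHard : Prop :=
  IsNPHard KroneckerPositivity

/-- **Fischer–Ikenmeyer 2020, Thm. 1: "PLETHYSMPOSITIVITY(`m`) ... NP-hard for any fixed
`m ≥ 3`. In particular, PLETHYSMPOSITIVITY ... NP-hard"** (unary or binary inputs, §3).
[cite: FischerIkenmeyer2020, Thm. 1] -/
def FischerIkenmeyer2020_plethysmNPHard : Prop :=
  (∀ m : ℕ, 3 ≤ m → IsNPHard (PlethysmPositivityFixed m)) ∧ IsNPHard PlethysmPositivity

/-! ### The technique class: GCT6's polynomial-time positivity hypotheses (registered OPEN statements)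

The three `Prop`s below are HYPOTHESES — the technique class this barrier stops (general forms)
and the form it spares (rectangular) — registered as open statements (`OPEN CONJECTURE — …`,
`[status: open]`, CONVENTIONS §4), not literature debt: none has, or is meant to get, a `_holds`
theorem. The two general forms are expected to be false (each yields `NP ⊆ P` by the no-go
theorems below); the rectangular form is open in the ordinary sense. -/

/-- OPEN CONJECTURE — **KRONECKER ∈ P** (`KroneckerPositivity ∈ P`: positivity of `k^λ_{μ,π}`
decidable in time polynomial in the unary input size), the barrier's technique-class HYPOTHESIS
in its general Kronecker form. POSED in GCT6: the decision problem is Problem 1.1 ("Decision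
version of the Kronecker problem: Given partitions `λ, μ, π`, decide nonvanishing of the Kronecker
coefficient") and its membership in `P` is Question 1.5 ("Do the decision problems above … belong
to `P`?") [cite: MulmuleyGCT6, Ch. 1 §1, Problem 1.1 and Question 1.5]; the affirmative answer
is "the early GCT conjecture [gct6]" [cite: Burgisser2024Completeness, §7] — "It was conjectured
in [GCT6] that the problem of deciding positivity of Kronecker coefficients is in `P`"
[cite: IkenmeyerMulmuleyWalter2017, §1.1], "it was originally conjectured that Kronecker
positivity would be decidable in polynomial time" [cite: FischerIkenmeyer2020, §1]. The 2009
revision of GCT6 itself warns that "these problems may not be in `P` in their strict form" and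
conjectures `P`-membership only of RELAXED forms (Hypothesis 1.6, PHflip), strict saturation
having failed for Kronecker coefficients "as was conjectured in the earlier version of this
paper" [cite: MulmuleyGCT6, Ch. 1 §1 (before Hypothesis 1.6) and §6 (before Hypothesis 6.5)].
Standing: expected to be FALSE and never to be discharged — KRONECKER is NP-hard
[cite: IkenmeyerMulmuleyWalter2017, Thm. 1.1], so this statement yields `NP ⊆ P`
(`KroneckerPlethysmHardness.np_subset_P_of_kronecker` below; "this is not so, in general,
assuming that `P ≠ NP`"); its negation is not in print either — that would be a superpolynomial
time lower bound for a problem which "can be computed in PSPACE"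
[cite: MulmuleyGCT6, Ch. 5 §1, Prop. 1.2]. Used only as the hypothesis
`(hP : KroneckerPositivityInP)` of the no-go theorems; there is deliberately no
`KroneckerPositivityInP_holds`, and the name is kept (not `…Conjecture`) because those theorems
and the barrier block refer to it. [status: open] -/
@[conjecture] def KroneckerPositivityInP : Prop :=
  KroneckerPositivity ∈ P

/-- OPEN CONJECTURE — **PLETHYSMPOSITIVITY ∈ P** (`PlethysmPositivity ∈ P`: positivity of
`a_λ(n,m)` decidable in polynomial time), the barrier's technique-class HYPOTHESIS in its
plethysm form. POSED in GCT6: Problem 1.2 ("Decision version of the plethysm problem":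
nonvanishing of the plethysm constant `a^π_{λ,μ}`, the multiplicity of `V_π(GL_n)` in
`V_λ(GL(V_μ))`; Fischer–Ikenmeyer's `a_λ(n,m)` is the case `a^λ_{(n),(m)}`,
`V_{(n)}(GL(Sym^m V)) = Sym^n Sym^m V`) with Question 1.5 ("Do the decision problems above …
belong to `P`?") [cite: MulmuleyGCT6, Ch. 1 §1, Problem 1.2 and Question 1.5]; "the early GCT
conjecture [gct6] that this [polynomial-time positivity testing, as for Littlewood–Richardson
coefficients] should also be possible for plethysm coefficients and Kronecker coefficients"
[cite: Burgisser2024Completeness, §7] [cite: FischerIkenmeyer2020, §1]. The 2009 revision of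
GCT6 conjectures `P`-membership only of the RELAXED plethysm problem (Hypothesis 1.6, PHflip:
(a) stretched constants `a^{bπ}_{bλ,bμ}` for `b > c·h^{c'}`, (b) an algorithm correct "on almost
all `λ, μ` and `π`"), derived from the polyhedral hypotheses PH1 and SH
[cite: MulmuleyGCT6, Ch. 1 §1, Hypothesis 1.6 and §6, Hypotheses 6.4–6.5, Thm. 6.8]. Standing:
expected to be FALSE and never to be discharged — PLETHYSMPOSITIVITY is NP-hard, already for
fixed inner parameter `m ≥ 3` [cite: FischerIkenmeyer2020, Thm. 1], so this statement yields
`NP ⊆ P` (`KroneckerPlethysmHardness.np_subset_P_of_plethysm` below); its negation is not in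
print either (the plethysm constant "can be computed in `poly(⟨λ⟩,⟨μ⟩,⟨π⟩)` space"
[cite: MulmuleyGCT6, Ch. 1 §6, Thm. 6.3]; computing `a_λ(n,m)` is `GapP`-complete
[cite: FischerIkenmeyer2020, Thm. 3]). Used only as the hypothesis
`(hP : PlethysmPositivityInP)`; deliberately no `_holds`; the name is kept (not `…Conjecture`)
because the no-go theorems and the barrier block refer to it. [status: open] -/
@[conjecture] def PlethysmPositivityInP : Prop :=
  PlethysmPositivity ∈ P

/-- OPEN CONJECTURE — **rectangular Kronecker positivity is in `P`**
(`RectangularKroneckerPositivity ∈ P`), the form of the positivity hypothesis GCT actually needs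
and the one this barrier does NOT touch ("only the weaker version of this conjecture for
rectangular Kronecker coefficients … is needed in GCT, since only such coefficients arise in
the study of the orbit closure of the determinant" [cite: IkenmeyerMulmuleyWalter2017, §1.1]).
POSED in GCT6 as PH1 for the determinant: for `g = det_m`, "the subgroup restriction problem for
the embedding `ρ : G_g ↪ G` is essentially the Kronecker problem", and Hypothesis 6.1 (PH1)
posits a polytope `Q^d_λ`, given by a separation oracle of polynomial encoding bitlength, whose
number of integer points is `m^d_λ`, the multiplicity of `(ℂg)^d` in `V_λ(G)` — the `d`-th
power of the determinant representation of `GL_m`, whose partition "is a rectangle of height `m`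
and width `d`", so that `m^d_λ` is the rectangular Kronecker coefficient `k^λ_{δ(λ),δ(λ)}` —
which together with SH makes the relaxed decision problem polynomial-time
[cite: MulmuleyGCT6, Ch. 7 §6.3, Hypothesis 6.1 (PH1), with Ch. 1 §1, Hypothesis 1.6 and §6, Thm. 6.8];
stated for the strict problem by IMW: "It is conjectured in [GCT6] that the problem deciding
positivity of the rectangular Kronecker coefficient `k^λ_{δ(λ),δ(λ)}` is in `P`", "not expected
to be NP-hard. Rather it is conjectured [GCT6] to be in `P`, and this is supported by the result
(Theorem 6.9) here" (`t^λ_{δ,δ} > 0` whenever `λ ⊢ dr` has at most `min(d², r²)` rows — a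
positivity result for the lower-bound function `t`, not a decision procedure for `k`)
[cite: IkenmeyerMulmuleyWalter2017, §6.5, §1.7 and Thm. 6.9]. Standing: open in the ordinary
sense — the held sources print neither a hardness result nor an algorithm for it. Defined for
the barrier's scope caveat (`evasions_known`), used by nothing, hence the `…Conjecture` name
(formerly `RectangularKroneckerPositivityInP`); deliberately no `_holds`. [status: open] -/
@[conjecture] def RectangularKroneckerPositivityInPConjecture : Prop :=
  RectangularKroneckerPositivity ∈ P

/-! ### The barrier fact and the no-go theorems -/

/-- **Positivity of Kronecker and plethysm coefficients is NP-hard (IMW 2017; FI 2020).** The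
barrier fact is the conjunction of the two vendored hardness theorems.

BARRIER
technique_class: GCT, GCT6-flip, explicit-obstructions, positivity-testing, Kronecker-positivity-in-P, plethysm-positivity-in-P, saturated-integer-programming
blocks: the flip / explicit-obstruction strategy via polynomial-time positivity testing of representation-theoretic multiplicities (saturated / positive integer programming, GCT6; `KroneckerPositivityInP`, `PlethysmPositivityInP`), i.e. the general positivity hypotheses of GCT6 — "the early GCT conjecture [gct6] that this [polynomial-time positivity, as for Littlewood–Richardson coefficients] should also be possible for plethysm coefficients and Kronecker coefficients" [cite: Burgisser2024Completeness, §7] — as a route to finding the obstructions that would prove `dc(per_m)` superpolynomial (`ValiantsHypothesis` via `ValiantsHypothesis/GCTMult`): KRONECKER (unary) is NP-hard [cite: IkenmeyerMulmuleyWalter2017, Thm. 1.1], so `KroneckerPositivityInP → NP ⊆ P` (`KroneckerPlethysmHardness.np_subset_P_of_kronecker`, proved), "this is not so, in general, assuming that `P ≠ NP`" [cite: IkenmeyerMulmuleyWalter2017, §1.1]; PLETHYSMPOSITIVITY is NP-hard even for fixed inner parameter `m ≥ 3` [cite: FischerIkenmeyer2020, Thm. 1], so `PlethysmPositivityInP →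 NP ⊆ P` (`KroneckerPlethysmHardness.np_subset_P_of_plethysm`, proved); "This was a setback for the GCT program ... Such a result would have made the search for obstructions (i.e., inequalities between coefficients) much easier" [cite: FischerIkenmeyer2020, §1].
because: point sets in `{0,…,r-1}³` with prescribed marginals give lower and upper bounds `t^λ_{μ,π}`-type for `k^λ_{μ,π}` (pyramids versus all point sets, Manivel / Bürgisser–Ikenmeyer / Vallejo), which coincide on suitable instances, so that positivity of the Kronecker coefficient encodes a discrete-tomography / 3-DIMENSIONAL MATCHING instance, NP-complete after Brunetti–Del Lungo–Gérard [cite: IkenmeyerMulmuleyWalter2017, §1.5 and §2 (Lemma 2.1)]; for plethysms the analogous sandwich `a̲_λ(n,3) ≤ a_λ(n,3) ≤ ā_λ(n,3)` by pyramids and point sets in a cone, tight when the marginal is extremal, reduces a tomography problem to PLETHYSMPOSITIVITY(3), and `m ≥ 3` follows from `a_λ(n,m) = b_π(n,m+1)` [cite: FischerIkenmeyer2020, §3 (Thm. 4, Prop. 2, Lemma 1)].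
evasions_known: only RECTANGULAR Kronecker coefficients `k^λ_{δ(λ),δ(λ)}` arise for the orbit closure of the determinant, and their positivity "is not expected to be NP-hard. Rather it is conjectured [GCT6] to be in `P`" (`RectangularKroneckerPositivityInPConjecture`, open), supported by `t^λ_{δ,δ} > 0` for `ℓ(λ) ≤ min(d², r²)` [cite: IkenmeyerMulmuleyWalter2017, §1.1, §1.7 and Thm. 6.9]; positivity is polynomial-time for bounded heights and conjecturally for hooks [cite: IkenmeyerMulmuleyWalter2017, Thms. 6.4 and 6.6], and plethysm coefficients with fixed OUTER parameter are computable in polynomial time [cite: FischerIkenmeyer2020, Prop. 1]; existence of obstructions is a separate matter from the complexity of deciding positivity — IMW read their explicit constructions (Thm. 1.4: `Ω(2^{m^a})` vanishing triples inside the Kronecker cone) as "a step towards proving the existence of occurrence-based representation-theoretic obstructions" [cite: IkenmeyerMulmuleyWalter2017, §1.4 and §1.7] (occurrence obstructions were later excluded for `n ≥ m^25`, tree `Literature.Barriers.ValiantsHypothesis.GCTOccurrenceObstructions`).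
scope_caveats: the theorems are hardness of the GENERAL positivity problems; nothing is proved about the rectangular Kronecker coefficients or about the specific plethysm/Kronecker comparisons GCT needs, so the barrier bears on GCT6's hypotheses in their general form only [cite: IkenmeyerMulmuleyWalter2017, §1.1]; the theorems concern the STRICT decision problems, which the 2009 revision of GCT6 poses only as Question 1.5 ("these problems may not be in `P` in their strict form"), its standing hypothesis PHflip being `P`-membership of RELAXED forms (stretched constants; algorithms correct on almost all inputs) via PH1 and SH [cite: MulmuleyGCT6, Ch. 1 §1, Question 1.5 and Hypothesis 1.6; §6, Thm. 6.8] — nothing here is proved about those relaxed forms (the Kronecker-cone membership problem is in `NP ∩ coNP` [cite: IkenmeyerMulmuleyWalter2017, §1.5 (citing [BCMW])]), and the strict polynomial-time conjecture is attributed to GCT6 by IMW, FI and Bürgisser ("the early GCT conjecture") and, for strict saturation, by the revision itself ("as was conjectured in the earlier version of this paper") [cite: MulmuleyGCT6, Ch. 1 §6 (before Hypothesis 6.5)]; membership of KRONECKER in `NP` is not known (a `#P`-formula is conjectural; Thm. 1.2 gives one for a subclass) [cite: IkenmeyerMulmuleyWalter2017, §1.2]; the Lean languages fix one unary encoding and,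 for plethysms, `dim V = |λ|`; GCT6 is held only as the TeX text of its 2009 revision (IMW cite the 2010 technical-report version).
status: theorem (established) [cite: IkenmeyerMulmuleyWalter2017, Thm. 1.1] [cite: FischerIkenmeyer2020, Thm. 1] -/
def KroneckerPlethysmHardness : Prop :=
  IMW2017_kroneckerNPHard ∧ FischerIkenmeyer2020_plethysmNPHard

/-- Unfolding of the barrier fact. [folklore] -/
theorem kroneckerPlethysmHardness_iff :
    KroneckerPlethysmHardness ↔ IMW2017_kroneckerNPHard ∧ FischerIkenmeyer2020_plethysmNPHard :=
  Iff.rfl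

/-- **No-go (Kronecker form):** GCT6's general Kronecker positivity hypothesis implies
`NP ⊆ P` ("this is not so, in general, assuming that `P ≠ NP`"). From IMW Thm. 1.1 and the
tree's proved closure of `P` under Karp reductions. [cite: IkenmeyerMulmuleyWalter2017, Thm. 1.1 and §1.1] -/
theorem KroneckerPlethysmHardness.np_subset_P_of_kronecker (h : KroneckerPlethysmHardness)
    (hP : KroneckerPositivityInP) : NP ⊆ P :=
  NP_subset_P_of_isNPHard_of_mem_P_holds h.1 hP

/-- **No-go (plethysm form):** GCT6's plethysm positivity hypothesis implies `NP ⊆ P`.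
[cite: FischerIkenmeyer2020, Thm. 1] -/
theorem KroneckerPlethysmHardness.np_subset_P_of_plethysm (h : KroneckerPlethysmHardness)
    (hP : PlethysmPositivityInP) : NP ⊆ P :=
  NP_subset_P_of_isNPHard_of_mem_P_holds h.2.2 hP

/-- The fixed-parameter form: already PLETHYSMPOSITIVITY(3) in `P` gives `NP ⊆ P`.
[cite: FischerIkenmeyer2020, Thm. 1 (m = 3)] -/
theorem KroneckerPlethysmHardness.np_subset_P_of_plethysm_three (h : KroneckerPlethysmHardness)
    (hP : PlethysmPositivityFixed 3 ∈ P) : NP ⊆ P :=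
  NP_subset_P_of_isNPHard_of_mem_P_holds (h.2.1 3 le_rfl) hP

/-- Contrapositive packaging: if `NP ⊄ P` then neither general positivity hypothesis holds.
[cite: IkenmeyerMulmuleyWalter2017, §1.1] [cite: FischerIkenmeyer2020, §1] -/
theorem KroneckerPlethysmHardness.not_inP (h : KroneckerPlethysmHardness) (hNP : ¬ NP ⊆ P) :
    ¬ KroneckerPositivityInP ∧ ¬ PlethysmPositivityInP :=
  ⟨fun hK => hNP (h.np_subset_P_of_kronecker hK), fun hPl => hNP (h.np_subset_P_of_plethysm hPl)⟩

end Literature.Barriers.ValiantsHypothesis
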